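import Literature.NumberTheory.ComplexMultiplication.CMOrderWeakEquivalenceSingularPrimes
import Literature.NumberTheory.ComplexMultiplication.CMTorusIsomorphismClassesMaximalEndomorphismRingCount
import HarnessLib

/-!
# `𝔭`-equivalence classes of `R` are weak equivalence classes of `T = R + 𝔭ⁿ𝒪` (MARSEGLIA 2025 PROP. 4.3):
# for an over-order `T` with `T_𝔭 = R_𝔭` and `T_𝔮 = 𝒪_𝔮` (`𝔮 ≠ 𝔭`), `ψ : W(T) → W_𝔭(R)` is injective
# (`T`-ideals are weakly equivalent iff `𝔭`-equivalent), surjective (`[I₀]_𝔭 = [I₀T]_𝔭`), and matches `W̄(T)`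
# with `W̄_𝔭(R)` (`(I₀:I₀)_𝔭 = R_𝔭 ⟹ (I₀T:I₀T) = T`)

Family `hodge`, lane `lit-hodgefound` (Track 2 foundations library; seat p15, row g26-#12), topic
`Literature/NumberTheory/ComplexMultiplication`, namespace `Literature.NumberTheory.ComplexMultiplication.EndOrder` (the
order `𝔯 = endOrder ρ ⊆ 𝒪 = 𝓞_K` of the series, any degree).  THEOREMS ONLY: no definition, no instance, no named
fact (net Literature debt `0`).  Vocabulary: `FractionalIdeal (endOrder ρ)⁰ K`; the maximal order is an idempotent
`M = MM ≠ 0` with `↑M = (algebraMap (𝓞 K) K).range` (`CMTorusIsomorphismClassesMaximalEndomorphismRingCount`); the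
over-order `T` is ANY fractional ideal with the local data `T_𝔭 = R_𝔭·1`, `T_𝔮 = M_𝔮` (`𝔮 ≠ 𝔭` maximal) — the
`T = R + 𝔭ⁿ𝒪 = 1 + 𝔭ⁿ·M` of `CMOrderLocalOverorderAtPrime.exists_overorder_span_coe_eq` (Lemma 4.1 (1)) is one;
a fractional `T`-ideal is an `𝔯`-ideal `I` with `TI = I`; «weakly equivalent» is `1 ∈ (I:J)(J:I)`,
«`𝔭`-equivalent» is `1 ∈ (I:J)(J:I) + 𝔭` (Prop. 3.2 (4)); `R_𝔭 = Localization.subalgebra.ofField K 𝔭.primeCompl _`,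
`I_𝔭 = span R_𝔭 ↑I`.

## Source, VERBATIM

S. Marseglia, *Local isomorphism classes of fractional ideals of orders in étale algebras*, J. Algebra 673 (2025)
77–102 [Marseglia2025LocalIsomorphism] (arXiv:2311.18571, held `paper:arxiv-2311.18571`, chunk p0008):
"Proposition 4.3. We have a natural monoid isomorphism `W_𝔭(R) ⟷ W(R + 𝔭^{n_𝔭}𝒪)`, which induces a bijection
`W̄_𝔭(R) ⟷ W̄(R + 𝔭^{n_𝔭}𝒪)`.  Proof. Put `T = R + 𝔭^{n_𝔭}𝒪`. Firstly, observe that every fractional `T`-ideal is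
naturally a fractional `R`-ideal. Secondly, two fractional `T`-ideals `I` and `J` are weakly equivalent if and only
if they are `𝔭T`-equivalent, by Lemma 4.1.(1). By Lemma 4.1.(4) we have a canonical isomorphism `T_{𝔭T} ≃ R_𝔭`,
which implies that `I` and `J` are `𝔭T`-equivalent if and only if they are `𝔭`-equivalent. Hence, we have a natural
injective map of commutative monoids `ψ : W(T) → W_𝔭(R)`. This map is also surjective since the pre-image of the
class in `W_𝔭(R)` of a fractional `R`-ideal `I₀` is given by the class in `W(T)` of `I₀T`. Since `R_𝔭 = T_𝔭` by
Lemma 4.1.(1), we deduce that `ψ(W̄(T)) ⊆ W̄_𝔭(R)`. Moreover, if `I₀` is a fractional `R`-ideal with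
`(I₀:I₀)_𝔭 = R_𝔭`, then `(I₀T:I₀T)_𝔭 = (I₀T_𝔭 : I₀T_𝔭) = (I₀R_𝔭 : I₀R_𝔭) = (I₀:I₀)_𝔭 = R_𝔭 = T_𝔭`, and
`(I₀T:I₀T)_𝔮 = (I₀T_𝔮 : I₀T_𝔮) = (I₀𝒪_𝔮 : I₀𝒪_𝔮) = 𝒪_𝔮 = T_𝔮`, for every maximal ideal `𝔮 ≠ 𝔭`. Hence, the
multiplicator ring of `I₀T` is `T`, showing that `ψ(W̄(T)) = W̄_𝔮(R)`, as required. □"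

The injectivity is obtained here WITHOUT passing through the spectrum of `T` (Lemma 4.1 (2)–(4) are not in the tree):
two `T`-ideals that are `𝔭`-equivalent are `𝔮`-equivalent at every other maximal `𝔮` because there they localise
like the `𝒪`-ideals `𝒪I`, `𝒪J`, and any two ideals with multiplicator ring `𝒪` are weakly equivalent
(`EndOrder.one_mem_div_mul_div_of_coe_div_self_eq_range`); weak equivalence then follows from Prop. 3.4
(`CMOrderWeakEquivalenceSingularPrimes`).

## What is formalised

* **`span_coe_eq_span_coe_mul_of_mul_eq`** (`I_𝔮 = (𝒪I)_𝔮` for a `T`-ideal `I` and `𝔮 ≠ 𝔭`), `mul_mul_eq_mul_of_mul_self_eq`,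
  `coe_mul_div_self_eq_range` / `mul_div_mul_self_eq` (`𝒪I` has multiplicator ring `𝒪`).
* **`one_mem_div_mul_div_of_one_mem_add_coeIdeal_of_mul_eq`** (ψ INJECTIVE: `𝔭`-equivalent `T`-ideals are weakly
  equivalent), **`one_mem_div_mul_div_iff_one_mem_add_coeIdeal_of_mul_eq`** (iff).
* **`one_mem_add_coeIdeal_mul_self`** (ψ SURJECTIVE: `I₀T` is `𝔭`-equivalent to `I₀`).
* **`mul_div_mul_eq_of_span_coe_div_self_eq_span_one`** (`(I₀:I₀)_𝔭 = R_𝔭 ⟹ (I₀T:I₀T) = T`) and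
  `span_coe_div_self_eq_span_one_of_div_self_eq` (`(I:I) = T ⟹ (I:I)_𝔭 = R_𝔭`): `ψ(W̄(T)) = W̄_𝔭(R)`.
-/

open scoped nonZeroDivisors NumberField
open Module FractionalIdeal NumberField

namespace Literature.NumberTheory.ComplexMultiplication

namespace EndOrder

variable {K : Type} [Field K] [NumberField K]
variable {ι : Type} [Fintype ι] [DecidableEq ι] [Nonempty ι] {ρ : K →ₐ[ℚ] Matrix ι ι ℚ}
variable [IsFractionRing (endOrder ρ) K]

omit [Nonempty ι] [IsFractionRing (endOrder ρ) K] in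
/-- `T(TI) = TI` for an idempotent `T`: the extension `I₀T` is a `T`-ideal. [cite: Marseglia2025LocalIsomorphism, §4,
proof of Prop. 4.3 («the class in `W(T)` of `I₀T`»), p. 8] -/
theorem mul_mul_eq_mul_of_mul_self_eq {T : FractionalIdeal (endOrder ρ)⁰ K} (hTT : T * T = T)
    (I : FractionalIdeal (endOrder ρ)⁰ K) : T * (T * I) = T * I := by
  rw [← mul_assoc, hTT]

omit [Nonempty ι] in
/-- **At `𝔮 ≠ 𝔭` a `T`-ideal localises like an `𝒪`-ideal: `I_𝔮 = (TI)_𝔮 = T_𝔮I_𝔮 = 𝒪_𝔮I_𝔮 = (𝒪I)_𝔮`** (for any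
`T`, `M` with `T_𝔮 = M_𝔮` and `TI = I`). [cite: Marseglia2025LocalIsomorphism, §4, proof of Prop. 4.3
(«`(I₀T_𝔮 : I₀T_𝔮) = (I₀𝒪_𝔮 : I₀𝒪_𝔮)`»), p. 8] -/
theorem span_coe_eq_span_coe_mul_of_mul_eq {T M I : FractionalIdeal (endOrder ρ)⁰ K} (hTI : T * I = I)
    (𝔮 : Ideal (endOrder ρ)) [𝔮.IsPrime]
    (hT : Submodule.span (Localization.subalgebra.ofField K 𝔮.primeCompl 𝔮.primeCompl_le_nonZeroDivisors) (T : Set K) =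
      Submodule.span (Localization.subalgebra.ofField K 𝔮.primeCompl 𝔮.primeCompl_le_nonZeroDivisors) (M : Set K)) :
    Submodule.span (Localization.subalgebra.ofField K 𝔮.primeCompl 𝔮.primeCompl_le_nonZeroDivisors) (I : Set K) =
      Submodule.span (Localization.subalgebra.ofField K 𝔮.primeCompl 𝔮.primeCompl_le_nonZeroDivisors)
        ((M * I : FractionalIdeal (endOrder ρ)⁰ K) : Set K) := by
  conv_lhs => rw [← hTI]
  rw [NumberRing.span_coe_mul, hT, ← NumberRing.span_coe_mul]

omit [IsFractionRing (endOrder ρ) K] in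
/-- **`𝒪I` has multiplicator ring `𝒪`**: `↑((MI):(MI)) = 𝓞_K` for the idempotent `M` with `↑M = 𝓞_K` and `I ≠ 0`.
[cite: Marseglia2025LocalIsomorphism, §4, proof of Prop. 4.3 («`(I₀𝒪_𝔮 : I₀𝒪_𝔮) = 𝒪_𝔮`»), p. 8]
[cite: Marseglia2019, §3 («`ICM(𝒪_K) = Pic(𝒪_K)`»), p. 6] -/
theorem coe_mul_div_self_eq_range [IsFractionRing (endOrder ρ) K] {M : FractionalIdeal (endOrder ρ)⁰ K}
    (hMM : M * M = M) (hM0 : M ≠ 0) (hMO : (M : Set K) = (algebraMap (𝓞 K) K).range)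
    {I : FractionalIdeal (endOrder ρ)⁰ K} (hI : I ≠ 0) :
    ((M * I / (M * I) : FractionalIdeal (endOrder ρ)⁰ K) : Set K) = (algebraMap (𝓞 K) K).range :=
  (coe_div_self_eq_range_iff (fractionalIdeal_mul_ne_zero hM0 hI)).2
    ((mul_eq_iff_forall_mul_mem_of_coe_eq_range hMO).1 (mul_mul_eq_mul_of_mul_self_eq hMM I))

/-- **… i.e. `(MI : MI) = M`.** [cite: Marseglia2025LocalIsomorphism, §4, proof of Prop. 4.3, p. 8] -/
theorem mul_div_mul_self_eq {M : FractionalIdeal (endOrder ρ)⁰ K} (hMM : M * M = M) (hM0 : M ≠ 0)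
    (hMO : (M : Set K) = (algebraMap (𝓞 K) K).range) {I : FractionalIdeal (endOrder ρ)⁰ K} (hI : I ≠ 0) :
    M * I / (M * I) = M :=
  SetLike.coe_injective ((coe_mul_div_self_eq_range hMM hM0 hMO hI).trans hMO.symm)

/-- **PROPOSITION 4.3, ψ IS INJECTIVE: two `T`-ideals that are `𝔭`-equivalent are weakly equivalent**, for any
over-order `T` with `T_𝔮 = 𝒪_𝔮` at every maximal `𝔮 ≠ 𝔭` («two fractional `T`-ideals `I` and `J` are weakly
equivalent if and only if they are `𝔭T`-equivalent … if and only if they are `𝔭`-equivalent»; here: at `𝔮 ≠ 𝔭`,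
`((I:J)(J:I))_𝔮 = ((𝒪I:𝒪J)(𝒪J:𝒪I))_𝔮 ∋ 1`). [cite: Marseglia2025LocalIsomorphism, §4 Prop. 4.3 (proof, injectivity of
`ψ`), p. 8] -/
theorem one_mem_div_mul_div_of_one_mem_add_coeIdeal_of_mul_eq {T M I J : FractionalIdeal (endOrder ρ)⁰ K}
    (hMM : M * M = M) (hM0 : M ≠ 0) (hMO : (M : Set K) = (algebraMap (𝓞 K) K).range)
    (𝔭 : MaximalSpectrum (endOrder ρ))
    (hT : ∀ 𝔮 : MaximalSpectrum (endOrder ρ), 𝔮 ≠ 𝔭 →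
      Submodule.span (Localization.subalgebra.ofField K 𝔮.asIdeal.primeCompl
          𝔮.asIdeal.primeCompl_le_nonZeroDivisors) (T : Set K) =
        Submodule.span (Localization.subalgebra.ofField K 𝔮.asIdeal.primeCompl
          𝔮.asIdeal.primeCompl_le_nonZeroDivisors) (M : Set K))
    (hI : I ≠ 0) (hJ : J ≠ 0) (hTI : T * I = I) (hTJ : T * J = J)
    (h𝔭 : (1 : K) ∈ I / J * (J / I) + (𝔭.asIdeal : FractionalIdeal (endOrder ρ)⁰ K)) :
    (1 : K) ∈ I / J * (J / I) := by
  haveI := CMTypeLattice.isNoetherianRing_endOrder ρ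
  refine one_mem_div_mul_div_of_forall_one_mem_add_coeIdeal hI hJ fun 𝔮 _ ↦ ?_
  by_cases h𝔮 : 𝔮 = 𝔭
  · subst h𝔮; exact h𝔭
  · haveI := 𝔮.isMaximal
    have hMI0 : M * I ≠ 0 := fractionalIdeal_mul_ne_zero hM0 hI
    have hMJ0 : M * J ≠ 0 := fractionalIdeal_mul_ne_zero hM0 hJ
    -- `𝒪I`, `𝒪J` have multiplicator ring `𝒪`, hence are weakly equivalent
    have hwk : (1 : K) ∈ M * I / (M * J) * (M * J / (M * I)) :=
      one_mem_div_mul_div_of_coe_div_self_eq_range hMI0 (coe_mul_div_self_eq_range hMM hM0 hMO hI) hMJ0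
        (coe_mul_div_self_eq_range hMM hM0 hMO hJ)
    -- and `((I:J)(J:I))_𝔮 = ((𝒪I:𝒪J)(𝒪J:𝒪I))_𝔮`
    -- (`CMOrderPEquivalenceLocalIsomorphism.span_coe_div_mul_div_eq_of_span_coe_eq_of_span_coe_eq`, inlined)
    rw [← NumberRing.one_mem_span_coe_iff_one_mem_add_coeIdeal, NumberRing.span_coe_mul, NumberRing.span_coe_div hJ,
      NumberRing.span_coe_div hI, span_coe_eq_span_coe_mul_of_mul_eq hTI 𝔮.asIdeal (hT 𝔮 h𝔮),
      span_coe_eq_span_coe_mul_of_mul_eq hTJ 𝔮.asIdeal (hT 𝔮 h𝔮), ← NumberRing.span_coe_div hMJ0,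
      ← NumberRing.span_coe_div hMI0, ← NumberRing.span_coe_mul]
    exact Submodule.subset_span hwk

/-- **PROPOSITION 4.3, `W(T) ↪ W_𝔭(R)` as an iff: `T`-ideals are weakly equivalent iff they are `𝔭`-equivalent.**
[cite: Marseglia2025LocalIsomorphism, §4 Prop. 4.3, p. 8] -/
theorem one_mem_div_mul_div_iff_one_mem_add_coeIdeal_of_mul_eq {T M I J : FractionalIdeal (endOrder ρ)⁰ K}
    (hMM : M * M = M) (hM0 : M ≠ 0) (hMO : (M : Set K) = (algebraMap (𝓞 K) K).range)
    (𝔭 : MaximalSpectrum (endOrder ρ))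
    (hT : ∀ 𝔮 : MaximalSpectrum (endOrder ρ), 𝔮 ≠ 𝔭 →
      Submodule.span (Localization.subalgebra.ofField K 𝔮.asIdeal.primeCompl
          𝔮.asIdeal.primeCompl_le_nonZeroDivisors) (T : Set K) =
        Submodule.span (Localization.subalgebra.ofField K 𝔮.asIdeal.primeCompl
          𝔮.asIdeal.primeCompl_le_nonZeroDivisors) (M : Set K))
    (hI : I ≠ 0) (hJ : J ≠ 0) (hTI : T * I = I) (hTJ : T * J = J) :
    (1 : K) ∈ I / J * (J / I) ↔ (1 : K) ∈ I / J * (J / I) + (𝔭.asIdeal : FractionalIdeal (endOrder ρ)⁰ K) :=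
  ⟨fun h ↦ one_mem_add_coeIdeal_of_one_mem h _,
    one_mem_div_mul_div_of_one_mem_add_coeIdeal_of_mul_eq hMM hM0 hMO 𝔭 hT hI hJ hTI hTJ⟩

/-- **PROPOSITION 4.3, ψ IS SURJECTIVE: `I₀T` is `𝔭`-equivalent to `I₀`** whenever `T_𝔭 = R_𝔭` («the pre-image of the
class in `W_𝔭(R)` of a fractional `R`-ideal `I₀` is given by the class in `W(T)` of `I₀T`»: `(TI₀)_𝔭 = 1·(I₀)_𝔭`).
[cite: Marseglia2025LocalIsomorphism, §4 Prop. 4.3 (proof, surjectivity of `ψ`), p. 8] -/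
theorem one_mem_add_coeIdeal_mul_self {T I₀ : FractionalIdeal (endOrder ρ)⁰ K} (hT0 : T ≠ 0) (hI₀ : I₀ ≠ 0)
    (𝔭 : Ideal (endOrder ρ)) [𝔭.IsMaximal]
    (hT𝔭 : Submodule.span (Localization.subalgebra.ofField K 𝔭.primeCompl 𝔭.primeCompl_le_nonZeroDivisors)
        (T : Set K) =
      Submodule.span (Localization.subalgebra.ofField K 𝔭.primeCompl 𝔭.primeCompl_le_nonZeroDivisors) {1}) :
    (1 : K) ∈ T * I₀ / I₀ * (I₀ / (T * I₀)) + (𝔭 : FractionalIdeal (endOrder ρ)⁰ K) :=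
  haveI := CMTypeLattice.isNoetherianRing_endOrder ρ
  NumberRing.one_mem_add_coeIdeal_of_span_coe_eq (fractionalIdeal_mul_ne_zero hT0 hI₀) hI₀ 𝔭 (x := 1)
    (by rw [NumberRing.span_coe_mul, hT𝔭])

/-- **PROPOSITION 4.3, `ψ(W̄(T)) = W̄_𝔭(R)`: if `(I₀:I₀)_𝔭 = R_𝔭` then `I₀T` has multiplicator ring exactly `T`**
(«`(I₀T:I₀T)_𝔭 = (I₀:I₀)_𝔭 = R_𝔭 = T_𝔭` and `(I₀T:I₀T)_𝔮 = (I₀𝒪_𝔮 : I₀𝒪_𝔮) = 𝒪_𝔮 = T_𝔮`», then (4-3)).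
[cite: Marseglia2025LocalIsomorphism, §4 Prop. 4.3 (proof, last part), p. 8] -/
theorem mul_div_mul_eq_of_span_coe_div_self_eq_span_one {T M I₀ : FractionalIdeal (endOrder ρ)⁰ K}
    (hMM : M * M = M) (hM0 : M ≠ 0) (hMO : (M : Set K) = (algebraMap (𝓞 K) K).range) (hT0 : T ≠ 0)
    (𝔭 : MaximalSpectrum (endOrder ρ))
    (hT𝔭 : Submodule.span (Localization.subalgebra.ofField K 𝔭.asIdeal.primeCompl
        𝔭.asIdeal.primeCompl_le_nonZeroDivisors) (T : Set K) =
      Submodule.span (Localization.subalgebra.ofField K 𝔭.asIdeal.primeCompl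
        𝔭.asIdeal.primeCompl_le_nonZeroDivisors) {1})
    (hT : ∀ 𝔮 : MaximalSpectrum (endOrder ρ), 𝔮 ≠ 𝔭 →
      Submodule.span (Localization.subalgebra.ofField K 𝔮.asIdeal.primeCompl
          𝔮.asIdeal.primeCompl_le_nonZeroDivisors) (T : Set K) =
        Submodule.span (Localization.subalgebra.ofField K 𝔮.asIdeal.primeCompl
          𝔮.asIdeal.primeCompl_le_nonZeroDivisors) (M : Set K))
    (hI₀ : I₀ ≠ 0)
    (h𝔭 : Submodule.span (Localization.subalgebra.ofField K 𝔭.asIdeal.primeCompl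
        𝔭.asIdeal.primeCompl_le_nonZeroDivisors) ((I₀ / I₀ : FractionalIdeal (endOrder ρ)⁰ K) : Set K) =
      Submodule.span (Localization.subalgebra.ofField K 𝔭.asIdeal.primeCompl
        𝔭.asIdeal.primeCompl_le_nonZeroDivisors) {1}) :
    T * I₀ / (T * I₀) = T := by
  haveI := CMTypeLattice.isNoetherianRing_endOrder ρ
  have hTI0 : T * I₀ ≠ 0 := fractionalIdeal_mul_ne_zero hT0 hI₀
  refine NumberRing.eq_iff_forall_span_coe_eq.2 fun 𝔮 ↦ ?_
  haveI := 𝔮.isMaximal.isPrime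
  by_cases h𝔮 : 𝔮 = 𝔭
  · -- at `𝔭`: `(TI₀:TI₀)_𝔭 = (I₀_𝔭 : I₀_𝔭) = (I₀:I₀)_𝔭 = R_𝔭 = T_𝔭`
    subst h𝔮
    rw [NumberRing.span_coe_div hTI0, NumberRing.span_coe_mul, hT𝔭, ← Submodule.one_eq_span, one_mul,
      ← NumberRing.span_coe_div hI₀, h𝔭, Submodule.one_eq_span]
  · -- at `𝔮 ≠ 𝔭`: `(TI₀:TI₀)_𝔮 = ((𝒪I₀):(𝒪I₀))_𝔮 = 𝒪_𝔮 = T_𝔮`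
    have hMI0 : M * I₀ ≠ 0 := fractionalIdeal_mul_ne_zero hM0 hI₀
    have hloc : Submodule.span (Localization.subalgebra.ofField K 𝔮.asIdeal.primeCompl
        𝔮.asIdeal.primeCompl_le_nonZeroDivisors) ((T * I₀ : FractionalIdeal (endOrder ρ)⁰ K) : Set K) =
      Submodule.span (Localization.subalgebra.ofField K 𝔮.asIdeal.primeCompl
        𝔮.asIdeal.primeCompl_le_nonZeroDivisors) ((M * I₀ : FractionalIdeal (endOrder ρ)⁰ K) : Set K) := by
      rw [NumberRing.span_coe_mul, hT 𝔮 h𝔮, ← NumberRing.span_coe_mul]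
    rw [NumberRing.span_coe_div hTI0, hloc, ← NumberRing.span_coe_div hMI0, mul_div_mul_self_eq hMM hM0 hMO hI₀,
      hT 𝔮 h𝔮]

omit [Nonempty ι] in
/-- **`ψ(W̄(T)) ⊆ W̄_𝔭(R)`: if `(I:I) = T` then `(I:I)_𝔭 = T_𝔭 = R_𝔭`** («Since `R_𝔭 = T_𝔭` by Lemma 4.1.(1)»).
[cite: Marseglia2025LocalIsomorphism, §4 Prop. 4.3 (proof), p. 8] -/
theorem span_coe_div_self_eq_span_one_of_div_self_eq {T I : FractionalIdeal (endOrder ρ)⁰ K} (hIT : I / I = T)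
    (𝔭 : Ideal (endOrder ρ)) [𝔭.IsPrime]
    (hT𝔭 : Submodule.span (Localization.subalgebra.ofField K 𝔭.primeCompl 𝔭.primeCompl_le_nonZeroDivisors)
        (T : Set K) =
      Submodule.span (Localization.subalgebra.ofField K 𝔭.primeCompl 𝔭.primeCompl_le_nonZeroDivisors) {1}) :
    Submodule.span (Localization.subalgebra.ofField K 𝔭.primeCompl 𝔭.primeCompl_le_nonZeroDivisors)
        ((I / I : FractionalIdeal (endOrder ρ)⁰ K) : Set K) =
      Submodule.span (Localization.subalgebra.ofField K 𝔭.primeCompl 𝔭.primeCompl_le_nonZeroDivisors) {1} := by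
  rw [hIT, hT𝔭]

end EndOrder

end Literature.NumberTheory.ComplexMultiplication
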